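import Literature.NumberTheory.EllipticCurves.GlobalMinimalModel
import Literature.NumberTheory.DiophantineGeometry.Conductor
import Mathlib.NumberTheory.Padics.PadicNumbers
import HarnessLib
import HarnessLib.Audit.Tags

/-!
# E-imc-75 `TameCellAtMostOneLocalTwoTorsionPoint` — on the TAME cell at `2` (`4 ∥ N`) a curve has AT MOST ONE
# `ℚ₂`-rational 2-torsion point (imc g14, MEMO-imc §20.2 T1 / §20.9), DATUM-FREE; the `p = 2` twin of E-imc-76u
# `TameThreeCharacter.TameThreeIIIAtMostOneLocalLine` — cell `bsd-f2-manin` (D-0131 (3) frontier)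

HONEST FRAMING.  LENS = IMC / local reducibility law (planner-of-record `bsd-f2-manin-imc`, g14; HOME
`run/shared/lean/pub/bsd-f2-manin/MEMO-imc.md` §20).  Source: HOME/imc/Sketch-imc-g14.lean sha16 **01cd4c12e8478e53**
:53–55 (`NoLocalTwoTorsionAtTwo`, VERBATIM) and :160–168 (the row), namespace `BsdF2ManinImcG14` ↦
`…ManinAdditive.TameTwoLocal`; the row is typed DATUM-FREE over `W.conductorNorm ℤ` exactly as refuter-1's T-54a shape
for its `p = 3` twin E-imc-76u (`TypeThreeSubgroupCharacter.lean`, p622115): the sketch's unused binder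
`(_D : ModularParametrizationData W N)` pins `N` to the conductor only through Carayol, so `2 ^ 2 ∣ N → ¬ 2 ^ 3 ∣ N`
becomes `2 ^ 2 ∣ W.conductorNorm ℤ → ¬ 2 ^ 3 ∣ W.conductorNorm ℤ`, and the two cubic equations are spelled
`IsLocalTwoTorsionX W x` (body = imc's cubic VERBATIM).  Typed now because (i) the row SURVIVED refuter-1 §R54
(R-imc-31/32: «THEOREM on paper, second reading VALID»), (ii) bsd-line-manin23-p2 g7 listed it as the one untyped §20
local row (INBOX 2026-08-28T11:29:02Z «E-imc-75 (p = 2 twin of 76u, untyped)»), and (iii) its proof path is in the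
tree's reach (imc T-imc-7: normal form `y² = x(x − w)(x − 4u)` + the Frey-at-2 rows — good sign I₁* at
`GeneralizedFermatTwoPowerCoefficientFreyTwoProofs` :358, bad sign I₀*/I₂*/I*_{2k−4} at
`Literature/NumberTheory/DiophantineGeometry/FreyCurveConductorTwoBadSignProofs.lean` p617833/p619796, never `f₂ = 2`).
Nothing here is asserted: the `@[conjecture]` row is a STATEMENT; the theorems are definitional edges.

THE ROW.  `4 ∥ N` (the tame cell at `2`: Kodaira IV or IV*, `f₂ = 2`) ⇒ the 2-division cubic
`Ψ₂² = 4x³ + b₂x² + 2b₄x + b₆` has AT MOST ONE root in `ℚ₂`, i.e. `#E(ℚ₂)[2] ≤ 2`; hence (imc) the invariant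
`σ = [E(ℚ₂)[2] ≠ 0]` is constant on isogeny classes of the tame cell.  WHY (MEMO-imc §20.9, refuter-1 §R54 second
reading): with all of `E[2]` rational over `ℚ₂` the curve is `y² = x(x − a)(x − b)`; integrality of the square completion
and potential good reduction force, after normalisation, `y² = x(x − w)(x − 4u)` with `u, w ∈ ℤ₂ˣ`, and Tate's algorithm
gives type I₀* (`f₂ = 4`, `w ≡ 1 (4)`) or I₁* (`f₂ = 3`, `w ≡ 3 (4)`), never `f₂ = 2`.

BC5 WITNESS (imc census g14-frob2b.out T1 + refuter-1 engine 2): 215 648 / 215 648 Cremona curves with `4 ∥ N`,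
`N < 5·10⁵`, have `#{ℚ₂-roots of Ψ₂²} ∈ {0, 1}`, never 3; `σ` class-constant 168 649 / 168 649 classes; refuter-1
R54-psi2loc-1e5.out 530ba08f936b0c2b: 46 920 / 46 920 curves `4 ∥ N`, `N < 10⁵`, `#ℚ₂-roots ≤ 1`; Tate sweep (kit PARI
j303579/j303605/j303622 + refuter-1 HOME/ref1/tate.py R54-e75fam.out f87c471021f017a9): `u, w` odd — 4 096 curves →
(3, I₁*) 2 048 [`w ≡ 3 (4)`] / (4, I₀*) 2 048 [`w ≡ 1 (4)`], `f₂ = 2`: 0; torsion-side sweep 32 640 curves `f₂ ∈ {0,1,3,4,5,6}`,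
never 2.  REFUTER VERDICTS: refuter-1 §R54 (HOME/ref1/R54-ref1-imcg14.md 2203741908967cef; kernel
HOME/ref1-C62-imcg14-audit.lean 6afda9362cddf4b4 rc 0 · 0/0/0; probes ref1-C62P-{A,B,C,D} 12/12 CLEAN): **SURVIVES —
THEOREM on paper (R-imc-32 second reading VALID)**; refuter-2 R-imc-34 placement pending.  PLACEMENT: the `ℓ = p = 2`
local statement is Tate-algorithm folklore in substance (Silverman ATAEC IV.9, Table 4.1; the Frey-curve-at-2 tables
of Diamond–Kramer 1995) but not printed as stated.  Theorems target: `TameCellAtMostOneLocalTwoTorsionPoint_holds`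
(prover work under `Summits/BirchSwinnertonDyer/BirchSwinnertonDyer/Theorems/`, via the ℤ₂-normal-form lemma + the two
Frey rows; the ℚ-global version with `ModularParametrizationData` is a one-line corollary through
`IsNewformOf.level_eq_conductorNorm_of_exists_isNewformOf`).  bears_on: stmt-BirchSwinnertonDyer-22967 (C2
`ManinOddAtFour`: residual R-IV′ / E-imc-73′, MEMO-imc §20.2).  PARTITION 0 · beyond-print theorem: no · BSD is not
proved by this; Manin's conjecture is not proved by this.
-/

set_option autoImplicit false

noncomputable section

namespace Summit.BirchSwinnertonDyer.Rank1Residual.ManinAdditive.TameTwoLocal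

/-- The 2-division cubic `Ψ₂² = 4x³ + b₂x² + 2b₄x + b₆` of `W` has no root in `ℚ₂`; ⟺ `E(ℚ₂)[2] = 0` ⟺ `E[2]` is an
irreducible `𝔽₂[G_{ℚ₂}]`-module (the image of `G_{ℚ₂}` in `S₃` contains a 3-cycle).  Decided per curve by 2-adic root
isolation. (imc g14 VERBATIM, HOME/imc/Sketch-imc-g14.lean :53–55.) -/
def NoLocalTwoTorsionAtTwo (W : WeierstrassCurve ℚ) : Prop :=
  ∀ x : ℚ_[2], 4 * x ^ 3 + (W.b₂ : ℚ_[2]) * x ^ 2 + 2 * (W.b₄ : ℚ_[2]) * x + (W.b₆ : ℚ_[2]) ≠ 0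

/-- `x` is a `ℚ₂`-rational root of the 2-division cubic `4x³ + b₂x² + 2b₄x + b₆`: the abscissa of a `ℚ₂`-rational
point of order `2` (body = the cubic of imc g14's row E-imc-75 VERBATIM). -/
def IsLocalTwoTorsionX (W : WeierstrassCurve ℚ) (x : ℚ_[2]) : Prop :=
  4 * x ^ 3 + (W.b₂ : ℚ_[2]) * x ^ 2 + 2 * (W.b₄ : ℚ_[2]) * x + (W.b₆ : ℚ_[2]) = 0

/-- `NoLocalTwoTorsionAtTwo W` says that no `x : ℚ₂` is a local 2-torsion abscissa. -/
theorem noLocalTwoTorsionAtTwo_iff (W : WeierstrassCurve ℚ) :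
    NoLocalTwoTorsionAtTwo W ↔ ∀ x : ℚ_[2], ¬ IsLocalTwoTorsionX W x :=
  Iff.rfl

/-- A RATIONAL root of the 2-division cubic is a `ℚ₂`-rational one. -/
theorem isLocalTwoTorsionX_ratCast (W : WeierstrassCurve ℚ) {x₀ : ℚ}
    (h : 4 * x₀ ^ 3 + W.b₂ * x₀ ^ 2 + 2 * W.b₄ * x₀ + W.b₆ = 0) : IsLocalTwoTorsionX W (x₀ : ℚ_[2]) := by
  unfold IsLocalTwoTorsionX
  exact_mod_cast h

/-- **Candidate E-imc-75 `TameCellAtMostOneLocalTwoTorsionPoint` (cell bsd-f2-manin, imc g14 MEMO-imc §20.2 T1; LAW →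
THEOREM on paper §20.9; DATUM-FREE per refuter-1 T-54a; nothing asserted):** on a global minimal model with `4 ∥ N` the
2-division cubic has AT MOST ONE root in `ℚ₂` — `E(ℚ₂)[2]` has order `≤ 2`.  The `p = 2` twin of E-imc-76u
`TameThreeCharacter.TameThreeIIIAtMostOneLocalLine`.  Census 215 648 / 215 648 (`4 ∥ N`, `N < 5·10⁵`), 0 exceptions;
expected proof = the finite Tate check on `y² = x(x − w)(x − 4u)`, `u, w ∈ ℤ₂ˣ` (I₀* or I₁*, never `f₂ = 2`).  REF1 §R54
(R-imc-31/32): **SURVIVES — THEOREM on paper**.  (imc g14 :160–168 with `_D`/`N` ↦ `W.conductorNorm ℤ` and the two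
cubic equations spelled `IsLocalTwoTorsionX`.)
[cite: SilvermanATAEC1994, IV.9.4 and Table 4.1 (Tate's algorithm at 2) (shape only: the at-most-one-local-2-torsion law on the tame cell is the cell's row E-imc-75, NOT printed as stated — MEMO-imc §20.9, refuter-1 §R54)] -/
@[conjecture]
def TameCellAtMostOneLocalTwoTorsionPoint : Prop :=
  ∀ (W : WeierstrassCurve ℚ) [W.IsElliptic] [W.IsGloballyMinimal],
    2 ^ 2 ∣ W.conductorNorm ℤ → ¬ 2 ^ 3 ∣ W.conductorNorm ℤ →
      ∀ x y : ℚ_[2], IsLocalTwoTorsionX W x → IsLocalTwoTorsionX W y → x = y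

/-- Under E-imc-75 a tame-cell curve has at most one RATIONAL 2-division root (one-line edge through
`isLocalTwoTorsionX_ratCast`). (PROVED.) -/
theorem atMostOne_ratTwoTorsionX_of_tameCell (h : TameCellAtMostOneLocalTwoTorsionPoint) (W : WeierstrassCurve ℚ)
    [W.IsElliptic] [W.IsGloballyMinimal] (h4 : 2 ^ 2 ∣ W.conductorNorm ℤ) (h8 : ¬ 2 ^ 3 ∣ W.conductorNorm ℤ)
    {x₀ y₀ : ℚ} (hx : 4 * x₀ ^ 3 + W.b₂ * x₀ ^ 2 + 2 * W.b₄ * x₀ + W.b₆ = 0)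
    (hy : 4 * y₀ ^ 3 + W.b₂ * y₀ ^ 2 + 2 * W.b₄ * y₀ + W.b₆ = 0) : x₀ = y₀ := by
  have := h W h4 h8 (x₀ : ℚ_[2]) (y₀ : ℚ_[2]) (isLocalTwoTorsionX_ratCast W hx) (isLocalTwoTorsionX_ratCast W hy)
  exact_mod_cast this

/-- Under E-imc-75, a tame-cell curve with NO `ℚ₂`-rational 2-torsion abscissa equal to a given local root `x` has none
other: the local root, when it exists, is unique (restatement for consumers quantifying over one root). (PROVED.) -/
theorem isLocalTwoTorsionX_unique_of_tameCell (h : TameCellAtMostOneLocalTwoTorsionPoint) (W : WeierstrassCurve ℚ)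
    [W.IsElliptic] [W.IsGloballyMinimal] (h4 : 2 ^ 2 ∣ W.conductorNorm ℤ) (h8 : ¬ 2 ^ 3 ∣ W.conductorNorm ℤ)
    {x : ℚ_[2]} (hx : IsLocalTwoTorsionX W x) : ∀ y : ℚ_[2], IsLocalTwoTorsionX W y → y = x :=
  fun y hy ↦ h W h4 h8 y x hy hx

end Summit.BirchSwinnertonDyer.Rank1Residual.ManinAdditive.TameTwoLocal

end
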